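import Literature.Analysis.FluidPDE.NSLocalAnalyticityRadiusReduction
import Literature.Analysis.FluidPDE.NSLocalAnalyticityRadiusScalingTools
import Literature.Analysis.FluidPDE.ClassicalSolutionRegionRescale
import HarnessLib

/-!
# BGK local analyticity radius: the parabolic-scaling reduction (WLOG `t = 1`, `x_c = 0`)

Analysis/FluidPDE proofs file (theorems only), companion of `NSLocalAnalyticityRadius.lean`
(named fact `bradshawGrujicKukavica2015_local_analyticity_radius`, Bradshaw–Grujić–Kukavica,
J. Differential Equations 259 (2015), Thm. 2.3; LMS Lecture Notes 430 (2016), Thm. 2.3.1).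

`NSLocalAnalyticityRadiusReduction.lean` reduced the fact to its *core* for pairs `(u, p)`
that are smooth solutions on a cylinder `(-δ, T₀) × B(x_c, 4r_*)` reaching across the initial
time. Here the core is reduced further, by the parabolic scaling
`v(s, y) = c u(c²s, x_c + c y)`, `π(s, y) = c² p(c²s, x_c + c y)`, `c = √t`
(`IsClassicalNSSolutionOnRegion.nsRescale_translate_of_isOpen`), to the single time `t = 1` and
the centre `x_c = 0`:

* `bgk_rescaled_hypotheses` — the rescaled pair is again a smooth solution, on
  `(-δ/c², T₀/c²) × B(0, 4r_*/c)`;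
* `bgk_rescaled_Lq_bound`, `bgk_rescaled_pressure_bound`, `bgk_rescaled_gradient_bound` — its
  three local quantities are bounded by `A' = c^{1-3/q}A`, `B' = c^{1-3/q}B`,
  `D' = c^{2-3/q-2/r}D`, so that `M' = c^{1-3/q}M` (`bgk_local_quantity_rescale`) and the window
  is `c⁻²` times the original one (`bgk_window_rescale`);
* `bgk_core_of_core_unit` — **if the conclusion of the core holds at time `1` for solutions about
  the origin, it holds at every time of the window for solutions about any centre**
  (`exists_extension_of_rescaled` transports the extension on `Ω_*(1)` back);
* `bradshawGrujicKukavica2015_local_analyticity_radius_of_core_unit` — combined with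
  `bradshawGrujicKukavica2015_local_analyticity_radius_of_core`: the fact follows from its
  unit-time, origin-centred core (constants `C₀ > 0`, `C ≥ 1`).

## References

* Z. Bradshaw, Z. Grujić, I. Kukavica, J. Differential Equations 259 (2015), Thm. 2.3 (pp. 4–5)
  and §4. [BradshawGrujicKukavica2015]
* L. Caffarelli, R. Kohn, L. Nirenberg, Comm. Pure Appl. Math. 35 (1982), (1.5)–(1.6).
  [CaffarelliKohnNirenberg1982]
-/

noncomputable section

open MeasureTheory Set Function Filter TopologicalSpace Metric Module
open _root_.Topology
open scoped ENNReal ContDiff Laplacian InnerProductSpace RealInnerProductSpace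
open Literature.Analysis.FunctionSpaces.EuclideanSpace (complexify complexify_apply norm_complexify
  complexify_injective continuous_complexify)

namespace Literature.Analysis.FluidPDE

/-! ### The rescaled pair is a smooth solution on the rescaled cylinder -/

/-- **The parabolic zoom of a locally smooth solution.** If `(u, p)` is a smooth solution of
`∂ₜu + (u·∇)u = Δu - ∇p`, `div u = 0` on `(-δ, T₀) × B(x_c, 4r)`, then
`v = c • u(c²·, x_c + c·)`, `π = c² • p(c²·, x_c + c·)` is one on `(-δ/c², T₀/c²) × B(0, 4(r/c))`
(`c > 0`). [cite: CaffarelliKohnNirenberg1982, (1.5)–(1.6)] -/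
theorem bgk_rescaled_hypotheses {xc : EuclideanSpace ℝ (Fin 3)} {rc T₀ δ c : ℝ} (hc : 0 < c)
    {u : ℝ → EuclideanSpace ℝ (Fin 3) → EuclideanSpace ℝ (Fin 3)}
    {p : ℝ → EuclideanSpace ℝ (Fin 3) → ℝ}
    (hu : ContDiffOn ℝ ∞ (uncurry u) (Ioo (-δ) T₀ ×ˢ ball xc (4 * rc)))
    (hp : ContDiffOn ℝ ∞ (uncurry p) (Ioo (-δ) T₀ ×ˢ ball xc (4 * rc)))
    (hns : ∀ t ∈ Ioo (-δ) T₀, ∀ x ∈ ball xc (4 * rc),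
      deriv (fun s => u s x) t + convect (u t) (u t) x = Δ (u t) x - gradient (p t) x)
    (hdiv : ∀ t ∈ Ioo (-δ) T₀, ∀ x ∈ ball xc (4 * rc), VectorCalculus.divergence (u t) x = 0) :
    ContDiffOn ℝ ∞ (uncurry (c • stPull (c ^ 2) c 0 xc u))
        (Ioo (-(δ / c ^ 2)) (T₀ / c ^ 2) ×ˢ ball 0 (4 * (rc / c))) ∧
      ContDiffOn ℝ ∞ (uncurry (c ^ 2 • stPull (c ^ 2) c 0 xc p))
        (Ioo (-(δ / c ^ 2)) (T₀ / c ^ 2) ×ˢ ball 0 (4 * (rc / c))) ∧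
      (∀ s ∈ Ioo (-(δ / c ^ 2)) (T₀ / c ^ 2),
        ∀ y ∈ ball (0 : EuclideanSpace ℝ (Fin 3)) (4 * (rc / c)),
        deriv (fun σ => (c • stPull (c ^ 2) c 0 xc u) σ y) s +
            convect ((c • stPull (c ^ 2) c 0 xc u) s) ((c • stPull (c ^ 2) c 0 xc u) s) y =
          Δ ((c • stPull (c ^ 2) c 0 xc u) s) y -
            gradient ((c ^ 2 • stPull (c ^ 2) c 0 xc p) s) y) ∧
      ∀ s ∈ Ioo (-(δ / c ^ 2)) (T₀ / c ^ 2),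
        ∀ y ∈ ball (0 : EuclideanSpace ℝ (Fin 3)) (4 * (rc / c)),
        VectorCalculus.divergence ((c • stPull (c ^ 2) c 0 xc u) s) y = 0 := by
  set Ω : Set (ℝ × EuclideanSpace ℝ (Fin 3)) := Ioo (-δ) T₀ ×ˢ ball xc (4 * rc) with hΩdef
  have hΩ : IsOpen Ω := isOpen_Ioo.prod isOpen_ball
  have hsol : IsClassicalNSSolutionOnRegion Ω 1 0 u p := by
    rw [isClassicalNSSolutionOnRegion_iff_of_isOpen hΩ]
    refine ⟨hu, hp, fun t x htx => ?_, fun t x htx => hdiv t htx.1 x htx.2⟩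
    simp only [one_smul, Pi.zero_apply, add_zero]
    exact hns t htx.1 x htx.2
  have hres := hsol.nsRescale_translate_of_isOpen hΩ hc 0 xc
  have hpre : stAffine (c ^ 2) c 0 xc ⁻¹' Ω =
      Ioo (-(δ / c ^ 2)) (T₀ / c ^ 2) ×ˢ ball 0 (4 * (rc / c)) := by
    rw [hΩdef, stAffine_preimage_cylinder (by positivity) hc, sub_zero, sub_zero, sub_self,
      smul_zero, neg_div, mul_div_assoc]
  rw [hpre] at hres
  have hΩ' : IsOpen (Ioo (-(δ / c ^ 2)) (T₀ / c ^ 2) ×ˢ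
      ball (0 : EuclideanSpace ℝ (Fin 3)) (4 * (rc / c))) := isOpen_Ioo.prod isOpen_ball
  obtain ⟨h1, h2, h3, h4⟩ := (isClassicalNSSolutionOnRegion_iff_of_isOpen hΩ').1 hres
  refine ⟨h1, h2, fun s hs y hy => ?_, fun s hs y hy => h4 s y ⟨hs, hy⟩⟩
  have := h3 s y ⟨hs, hy⟩
  simpa only [one_smul, Pi.smul_apply, stPull_apply, Pi.zero_apply, smul_zero, add_zero]
    using this

/-! ### The three local quantities of the rescaled pair -/

/-- `finrank ℝ ℝ³ = 3`, in the form of the volume factor `(c³)⁻¹`. [folklore] -/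
theorem volFactor_fin3 (c : ℝ) :
    ENNReal.ofReal (c ^ finrank ℝ (EuclideanSpace ℝ (Fin 3)))⁻¹ = ENNReal.ofReal (c ^ 3)⁻¹ := by
  rw [finrank_euclideanSpace_fin]

/-- **`L^q` bound of the rescaled velocity**: `‖v(s)‖_{L^q(B(0,4r/c))} = c^{1-3/q}
‖u(c²s)‖_{L^q(B(x_c,4r))} ≤ c^{1-3/q} A`. [folklore] -/
theorem bgk_rescaled_Lq_bound {xc : EuclideanSpace ℝ (Fin 3)} {rc c q A : ℝ} (hc : 0 < c)
    (hq : 0 < q) {u : ℝ → EuclideanSpace ℝ (Fin 3) → EuclideanSpace ℝ (Fin 3)}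
    {s : ℝ} (huA : eLpNorm (u (c ^ 2 * s)) (ENNReal.ofReal q)
      (volume.restrict (ball xc (4 * rc))) ≤ ENNReal.ofReal A) :
    eLpNorm ((c • stPull (c ^ 2) c 0 xc u) s) (ENNReal.ofReal q)
        (volume.restrict (ball (0 : EuclideanSpace ℝ (Fin 3)) (4 * (rc / c)))) ≤
      ENNReal.ofReal (c ^ (1 - 3 / q) * A) := by
  have hfun : (c • stPull (c ^ 2) c 0 xc u) s = fun y => c • u (c ^ 2 * s) (xc + c • y) := by
    funext y
    simp [stPull_apply]
  rw [hfun, eLpNorm_smul_comp_space_affine_restrict_ball (u (c ^ 2 * s)) c hc xc _ _,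
    volFactor_fin3, ← mul_assoc, enorm_mul_volFactor_eq_ofReal hc.le hc hq, bgk_rpow_one hc,
    show c * (4 * (rc / c)) = 4 * rc by field_simp, ENNReal.ofReal_mul (Real.rpow_nonneg hc.le _)]
  exact mul_le_mul' le_rfl huA

/-- **`L^{q/2}` bound of the rescaled pressure**: `‖π(s)‖_{L^{q/2}(B(0,4r/c))} ≤ (c^{1-3/q} B)²`.
[folklore] -/
theorem bgk_rescaled_pressure_bound {xc : EuclideanSpace ℝ (Fin 3)} {rc c q B : ℝ} (hc : 0 < c)
    (hq : 0 < q) {p : ℝ → EuclideanSpace ℝ (Fin 3) → ℝ} {s : ℝ}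
    (hpB : eLpNorm (p (c ^ 2 * s)) (ENNReal.ofReal (q / 2))
      (volume.restrict (ball xc (4 * rc))) ≤ ENNReal.ofReal (B ^ 2)) :
    eLpNorm ((c ^ 2 • stPull (c ^ 2) c 0 xc p) s) (ENNReal.ofReal (q / 2))
        (volume.restrict (ball (0 : EuclideanSpace ℝ (Fin 3)) (4 * (rc / c)))) ≤
      ENNReal.ofReal ((c ^ (1 - 3 / q) * B) ^ 2) := by
  have hfun : (c ^ 2 • stPull (c ^ 2) c 0 xc p) s =
      fun y => (c ^ 2) • p (c ^ 2 * s) (xc + c • y) := by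
    funext y
    simp [stPull_apply]
  have hq2 : 0 < q / 2 := by positivity
  rw [hfun, eLpNorm_smul_comp_space_affine_restrict_ball (p (c ^ 2 * s)) (c ^ 2) hc xc _ _,
    volFactor_fin3, ← mul_assoc, enorm_mul_volFactor_eq_ofReal (by positivity) hc hq2,
    show c * (4 * (rc / c)) = 4 * rc by field_simp]
  have hexp : c ^ 2 * c ^ (-3 / (q / 2)) = (c ^ (1 - 3 / q)) ^ 2 := by
    rw [← Real.rpow_two, ← Real.rpow_two, ← Real.rpow_mul hc.le, ← Real.rpow_add hc]
    congr 1
    field_simp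
    ring
  rw [hexp]
  calc ENNReal.ofReal ((c ^ (1 - 3 / q)) ^ 2) * eLpNorm (p (c ^ 2 * s)) (ENNReal.ofReal (q / 2))
        (volume.restrict (ball xc (4 * rc)))
      ≤ ENNReal.ofReal ((c ^ (1 - 3 / q)) ^ 2) * ENNReal.ofReal (B ^ 2) :=
        mul_le_mul' le_rfl hpB
    _ = ENNReal.ofReal ((c ^ (1 - 3 / q) * B) ^ 2) := by
        rw [← ENNReal.ofReal_mul (sq_nonneg _), mul_pow]

/-- The Frobenius norm of the gradient of the rescaled velocity: at every point,
`|∇v(s)|(y) = c² |∇u(c²s)|(x_c + c y)`. [folklore] -/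
theorem sqrt_frobeniusNormSq_fderiv_rescaled (xc : EuclideanSpace ℝ (Fin 3)) {c : ℝ} (hc : 0 < c)
    (u : ℝ → EuclideanSpace ℝ (Fin 3) → EuclideanSpace ℝ (Fin 3)) (s : ℝ)
    (y : EuclideanSpace ℝ (Fin 3)) :
    Real.sqrt (frobeniusNormSq (fderiv ℝ ((c • stPull (c ^ 2) c 0 xc u) s) y)) =
      (c ^ 2) • Real.sqrt (frobeniusNormSq (fderiv ℝ (u (c ^ 2 * s)) (xc + c • y))) := by
  rw [show (c • stPull (c ^ 2) c 0 xc u) s = c • stPull (c ^ 2) c 0 xc u s from rfl,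
    fderiv_const_smul_field, Pi.smul_apply, fderiv_stPull, smul_smul, frobeniusNormSq_smul,
    zero_add, Real.sqrt_mul (sq_nonneg _), Real.sqrt_sq (by positivity), smul_eq_mul, sq]

/-- **`L^r_t L^q_x` bound of the gradient of the rescaled velocity**:
`∫_{(-δ/c², T₀/c²)} ‖∇v(s)‖^r_{L^q(B(0,4r/c))} ds
= c^{(2-3/q)r - 2} ∫_{(-δ,T₀)} ‖∇u‖^r_{L^q(B(x_c,4r))} ≤ (c^{2-3/q-2/r} D)^r`. [folklore] -/
theorem bgk_rescaled_gradient_bound {xc : EuclideanSpace ℝ (Fin 3)} {rc T₀ δ c q r D : ℝ}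
    (hc : 0 < c) (hq : 0 < q) (hr : 0 < r) (hD : 0 ≤ D)
    {u : ℝ → EuclideanSpace ℝ (Fin 3) → EuclideanSpace ℝ (Fin 3)}
    (hgrad : ∫⁻ t in Ioo (-δ) T₀,
      eLpNorm (fun x => Real.sqrt (frobeniusNormSq (fderiv ℝ (u t) x)))
        (ENNReal.ofReal q) (volume.restrict (ball xc (4 * rc))) ^ r ≤ ENNReal.ofReal (D ^ r)) :
    ∫⁻ s in Ioo (-(δ / c ^ 2)) (T₀ / c ^ 2), eLpNorm
        (fun y => Real.sqrt (frobeniusNormSq (fderiv ℝ ((c • stPull (c ^ 2) c 0 xc u) s) y)))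
        (ENNReal.ofReal q) (volume.restrict (ball (0 : EuclideanSpace ℝ (Fin 3)) (4 * (rc / c))))
        ^ r ≤
      ENNReal.ofReal ((c ^ (2 - 3 / q - 2 / r) * D) ^ r) := by
  -- the slice norms
  set G : ℝ → ℝ≥0∞ := fun t => eLpNorm (fun x => Real.sqrt (frobeniusNormSq (fderiv ℝ (u t) x)))
    (ENNReal.ofReal q) (volume.restrict (ball xc (4 * rc))) with hG
  have hslice : ∀ s, eLpNorm
      (fun y => Real.sqrt (frobeniusNormSq (fderiv ℝ ((c • stPull (c ^ 2) c 0 xc u) s) y)))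
      (ENNReal.ofReal q)
      (volume.restrict (ball (0 : EuclideanSpace ℝ (Fin 3)) (4 * (rc / c)))) =
      ENNReal.ofReal (c ^ (2 - 3 / q)) * G (c ^ 2 * s) := by
    intro s
    have hfun : (fun y => Real.sqrt (frobeniusNormSq
        (fderiv ℝ ((c • stPull (c ^ 2) c 0 xc u) s) y))) =
        fun y => (c ^ 2) • Real.sqrt (frobeniusNormSq (fderiv ℝ (u (c ^ 2 * s)) (xc + c • y))) := by
      funext y
      exact sqrt_frobeniusNormSq_fderiv_rescaled xc hc u s y
    rw [hfun, eLpNorm_smul_comp_space_affine_restrict_ball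
      (fun x => Real.sqrt (frobeniusNormSq (fderiv ℝ (u (c ^ 2 * s)) x))) (c ^ 2) hc xc _ _,
      volFactor_fin3,
      ← mul_assoc, enorm_mul_volFactor_eq_ofReal (by positivity) hc hq, bgk_rpow_two hc,
      show c * (4 * (rc / c)) = 4 * rc by field_simp]
  simp_rw [hslice]
  have hK : ENNReal.ofReal (c ^ (2 - 3 / q)) ^ r ≠ ⊤ :=
    ENNReal.rpow_ne_top_of_nonneg hr.le ENNReal.ofReal_ne_top
  have hstep : ∀ s, (ENNReal.ofReal (c ^ (2 - 3 / q)) * G (c ^ 2 * s)) ^ r =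
      ENNReal.ofReal (c ^ (2 - 3 / q)) ^ r * G (c ^ 2 * s) ^ r := fun s =>
    ENNReal.mul_rpow_of_nonneg _ _ hr.le
  simp_rw [hstep]
  rw [lintegral_const_mul' _ _ hK]
  -- time change of variables
  have htime : ∫⁻ s in Ioo (-(δ / c ^ 2)) (T₀ / c ^ 2), G (c ^ 2 * s) ^ r =
      ENNReal.ofReal (c ^ 2)⁻¹ * ∫⁻ t in Ioo (-δ) T₀, G t ^ r := by
    rw [← neg_div]
    exact lintegral_Ioo_div_comp_mul (by positivity) (-δ) T₀ (fun t => G t ^ r)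
  rw [htime, ← mul_assoc]
  calc ENNReal.ofReal (c ^ (2 - 3 / q)) ^ r * ENNReal.ofReal (c ^ 2)⁻¹ *
        ∫⁻ t in Ioo (-δ) T₀, G t ^ r
      ≤ ENNReal.ofReal (c ^ (2 - 3 / q)) ^ r * ENNReal.ofReal (c ^ 2)⁻¹ *
        ENNReal.ofReal (D ^ r) := mul_le_mul' le_rfl hgrad
    _ = ENNReal.ofReal ((c ^ (2 - 3 / q - 2 / r) * D) ^ r) := by
        rw [ENNReal.ofReal_rpow_of_pos (Real.rpow_pos_of_pos hc _), ← Real.rpow_mul hc.le,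
          ← ENNReal.ofReal_mul (Real.rpow_nonneg hc.le _),
          ← ENNReal.ofReal_mul (mul_nonneg (Real.rpow_nonneg hc.le _) (by positivity)),
          bgk_rpow_grad hc hD hr]

/-! ### The reduction to unit time and the origin -/

/-- **WLOG `t = 1` and `x_c = 0`** (parabolic scaling, `c = √t`). Suppose that the conclusion
of the core holds at time `1` about the origin: for all data `(r, T₀, q, r', δ, u, p, A, B, D)`
as in the fact, centred at `0`, whose window contains `1`, the slice `u(1)` agrees on `B(0, r)`
with a map holomorphic on the local region of height `1/(4C₀)`. Then the conclusion holds at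
every time `t` of the window, for data about any centre `x_c`, with height `√t/(4C₀)`: apply the
hypothesis to `v(s, y) = √t u(ts, x_c + √t y)`, `π = t p(ts, x_c + √t y)`
(`bgk_rescaled_hypotheses`, `bgk_rescaled_*_bound`, `bgk_window_rescale`) and transport the
extension back (`exists_extension_of_rescaled`).
[cite: BradshawGrujicKukavica2015, Thm. 2.3 (scaling covariance of the statement)] -/
theorem bgk_core_of_core_unit {C₀ C : ℝ} (hC : 0 < C)
    (hunit : ∀ ⦃rc T₀ q r δ : ℝ⦄, 0 < rc → 0 < T₀ → 3 < q → 2 * q / (q - 3) < r → 0 < δ →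
      ∀ ⦃u : ℝ → EuclideanSpace ℝ (Fin 3) → EuclideanSpace ℝ (Fin 3)⦄
        ⦃p : ℝ → EuclideanSpace ℝ (Fin 3) → ℝ⦄,
        ContDiffOn ℝ ∞ (uncurry u) (Ioo (-δ) T₀ ×ˢ ball 0 (4 * rc)) →
        ContDiffOn ℝ ∞ (uncurry p) (Ioo (-δ) T₀ ×ˢ ball 0 (4 * rc)) →
        (∀ t ∈ Ioo (-δ) T₀, ∀ x ∈ ball (0 : EuclideanSpace ℝ (Fin 3)) (4 * rc),
          deriv (fun s => u s x) t + convect (u t) (u t) x = Δ (u t) x - gradient (p t) x) →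
        (∀ t ∈ Ioo (-δ) T₀, ∀ x ∈ ball (0 : EuclideanSpace ℝ (Fin 3)) (4 * rc),
          VectorCalculus.divergence (u t) x = 0) →
        ∀ ⦃A B D : ℝ⦄, 0 ≤ A → 0 ≤ B → 0 ≤ D →
        (∀ t ∈ Ioo (-δ) T₀, eLpNorm (u t) (ENNReal.ofReal q)
            (volume.restrict (ball 0 (4 * rc))) ≤ ENNReal.ofReal A) →
        (∀ t ∈ Ioo (-δ) T₀, eLpNorm (p t) (ENNReal.ofReal (q / 2))
            (volume.restrict (ball 0 (4 * rc))) ≤ ENNReal.ofReal (B ^ 2)) →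
        (∫⁻ t in Ioo (-δ) T₀, eLpNorm (fun x => Real.sqrt (frobeniusNormSq (fderiv ℝ (u t) x)))
            (ENNReal.ofReal q) (volume.restrict (ball 0 (4 * rc))) ^ r ≤
          ENNReal.ofReal (D ^ r)) →
        1 < C⁻¹ * min (min T₀ (rc ^ 2))
            (q ^ 2 * (C * (A + B + T₀ ^ ((r - 2) / (2 * r)) * D)) ^ (2 * q / (q - 3)))⁻¹ →
        ∃ U : EuclideanSpace ℂ (Fin 3) → EuclideanSpace ℂ (Fin 3),
          DifferentiableOn ℂ U (localComplexTube 0 rc (1 / (4 * C₀))) ∧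
          ∀ x ∈ ball (0 : EuclideanSpace ℝ (Fin 3)) rc, U (complexify x) = complexify (u 1 x))
    (xc : EuclideanSpace ℝ (Fin 3)) ⦃rc T₀ q r δ : ℝ⦄ (hrc : 0 < rc) (hT₀ : 0 < T₀) (hq : 3 < q)
    (hr : 2 * q / (q - 3) < r) (hδ : 0 < δ)
    ⦃u : ℝ → EuclideanSpace ℝ (Fin 3) → EuclideanSpace ℝ (Fin 3)⦄
    ⦃p : ℝ → EuclideanSpace ℝ (Fin 3) → ℝ⦄
    (hu : ContDiffOn ℝ ∞ (uncurry u) (Ioo (-δ) T₀ ×ˢ ball xc (4 * rc)))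
    (hp : ContDiffOn ℝ ∞ (uncurry p) (Ioo (-δ) T₀ ×ˢ ball xc (4 * rc)))
    (hns : ∀ t ∈ Ioo (-δ) T₀, ∀ x ∈ ball xc (4 * rc),
      deriv (fun s => u s x) t + convect (u t) (u t) x = Δ (u t) x - gradient (p t) x)
    (hdiv : ∀ t ∈ Ioo (-δ) T₀, ∀ x ∈ ball xc (4 * rc), VectorCalculus.divergence (u t) x = 0)
    ⦃A B D : ℝ⦄ (hA : 0 ≤ A) (hB : 0 ≤ B) (hD : 0 ≤ D)
    (huA : ∀ t ∈ Ioo (-δ) T₀, eLpNorm (u t) (ENNReal.ofReal q)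
      (volume.restrict (ball xc (4 * rc))) ≤ ENNReal.ofReal A)
    (hpB : ∀ t ∈ Ioo (-δ) T₀, eLpNorm (p t) (ENNReal.ofReal (q / 2))
      (volume.restrict (ball xc (4 * rc))) ≤ ENNReal.ofReal (B ^ 2))
    (hgrad : ∫⁻ t in Ioo (-δ) T₀, eLpNorm (fun x => Real.sqrt (frobeniusNormSq (fderiv ℝ (u t) x)))
      (ENNReal.ofReal q) (volume.restrict (ball xc (4 * rc))) ^ r ≤ ENNReal.ofReal (D ^ r))
    ⦃t : ℝ⦄ (ht : t ∈ Ioo 0 (C⁻¹ * min (min T₀ (rc ^ 2))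
      (q ^ 2 * (C * (A + B + T₀ ^ ((r - 2) / (2 * r)) * D)) ^ (2 * q / (q - 3)))⁻¹)) :
    ∃ U : EuclideanSpace ℂ (Fin 3) → EuclideanSpace ℂ (Fin 3),
      DifferentiableOn ℂ U (localComplexTube xc rc (Real.sqrt t / (4 * C₀))) ∧
      ∀ x ∈ ball xc rc, U (complexify x) = complexify (u t x) := by
  have hq0 : 0 < q := by linarith
  have hr0 : 0 < r := by
    have h1 : (0 : ℝ) < 2 * q / (q - 3) := div_pos (by linarith) (by linarith)
    exact h1.trans hr
  -- the scale `c = √t`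
  set c : ℝ := Real.sqrt t with hcdef
  have hc : 0 < c := Real.sqrt_pos.2 ht.1
  have hct : c ^ 2 = t := Real.sq_sqrt ht.1.le
  -- the rescaled pair and its data
  obtain ⟨hv, hπ, hns', hdiv'⟩ := bgk_rescaled_hypotheses (δ := δ) (T₀ := T₀) hc hu hp hns hdiv
  have hrc' : 0 < rc / c := div_pos hrc hc
  have hT₀' : 0 < T₀ / c ^ 2 := div_pos hT₀ (by positivity)
  have hδ' : 0 < δ / c ^ 2 := div_pos hδ (by positivity)
  have hshift : ∀ s ∈ Ioo (-(δ / c ^ 2)) (T₀ / c ^ 2), c ^ 2 * s ∈ Ioo (-δ) T₀ := by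
    intro s hs
    have hc2 : 0 < c ^ 2 := by positivity
    constructor
    · have := mul_lt_mul_of_pos_left hs.1 hc2
      rwa [mul_neg, mul_div_cancel₀ _ hc2.ne'] at this
    · have := mul_lt_mul_of_pos_left hs.2 hc2
      rwa [mul_div_cancel₀ _ hc2.ne'] at this
  have hA' : 0 ≤ c ^ (1 - 3 / q) * A := mul_nonneg (Real.rpow_nonneg hc.le _) hA
  have hB' : 0 ≤ c ^ (1 - 3 / q) * B := mul_nonneg (Real.rpow_nonneg hc.le _) hB
  have hD' : 0 ≤ c ^ (2 - 3 / q - 2 / r) * D := mul_nonneg (Real.rpow_nonneg hc.le _) hD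
  have huA' : ∀ s ∈ Ioo (-(δ / c ^ 2)) (T₀ / c ^ 2),
      eLpNorm ((c • stPull (c ^ 2) c 0 xc u) s) (ENNReal.ofReal q)
        (volume.restrict (ball (0 : EuclideanSpace ℝ (Fin 3)) (4 * (rc / c)))) ≤
      ENNReal.ofReal (c ^ (1 - 3 / q) * A) :=
    fun s hs => bgk_rescaled_Lq_bound hc hq0 (huA _ (hshift s hs))
  have hpB' : ∀ s ∈ Ioo (-(δ / c ^ 2)) (T₀ / c ^ 2),
      eLpNorm ((c ^ 2 • stPull (c ^ 2) c 0 xc p) s) (ENNReal.ofReal (q / 2))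
        (volume.restrict (ball (0 : EuclideanSpace ℝ (Fin 3)) (4 * (rc / c)))) ≤
      ENNReal.ofReal ((c ^ (1 - 3 / q) * B) ^ 2) :=
    fun s hs => bgk_rescaled_pressure_bound hc hq0 (hpB _ (hshift s hs))
  have hgrad' := bgk_rescaled_gradient_bound (xc := xc) (rc := rc) (T₀ := T₀) (δ := δ)
    hc hq0 hr0 hD hgrad
  -- the window of the rescaled data contains `1`
  have hM : 0 ≤ A + B + T₀ ^ ((r - 2) / (2 * r)) * D := by positivity
  have hwin : 1 < C⁻¹ * min (min (T₀ / c ^ 2) ((rc / c) ^ 2))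
      (q ^ 2 * (C * (c ^ (1 - 3 / q) * A + c ^ (1 - 3 / q) * B +
        (T₀ / c ^ 2) ^ ((r - 2) / (2 * r)) * (c ^ (2 - 3 / q - 2 / r) * D))) ^
          (2 * q / (q - 3)))⁻¹ := by
    rw [bgk_local_quantity_rescale hc hT₀ hr0.ne', bgk_window_rescale hc hC hM hq, hct,
      lt_div_iff₀ ht.1, one_mul]
    exact ht.2
  obtain ⟨U', hU'd, hU'f⟩ := hunit hrc' hT₀' hq hr hδ' hv hπ hns' hdiv' hA' hB' hD' huA' hpB'
    hgrad' hwin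
  -- transport back
  have hheight : Real.sqrt t / (4 * C₀) = c * (1 / (4 * C₀)) := by
    rw [hcdef]; ring
  rw [hheight]
  refine exists_extension_of_rescaled hc hU'd fun y hy => ?_
  rw [hU'f y hy]
  simp [stPull_apply, hct]

/-- **The fact from its unit-time, origin-centred core.** If, with constants `C₀ > 0` and
`C ≥ 1`, every smooth solution `(u, p)` on a cylinder `(-δ, T₀) × B(0, 4r_*)` whose window
contains the time `1` has its slice `u(1)` holomorphically extendable from `B(0, r_*)` to the
local region of height `1/(4C₀)`, then `bradshawGrujicKukavica2015_local_analyticity_radius`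
holds (`bgk_core_of_core_unit` and `bradshawGrujicKukavica2015_local_analyticity_radius_of_core`).
[cite: BradshawGrujicKukavica2015, Thm. 2.3 and §4] -/
theorem bradshawGrujicKukavica2015_local_analyticity_radius_of_core_unit {C₀ C : ℝ}
    (hC₀ : 0 < C₀) (hC : 1 ≤ C)
    (hunit : ∀ ⦃rc T₀ q r δ : ℝ⦄, 0 < rc → 0 < T₀ → 3 < q → 2 * q / (q - 3) < r → 0 < δ →
      ∀ ⦃u : ℝ → EuclideanSpace ℝ (Fin 3) → EuclideanSpace ℝ (Fin 3)⦄
        ⦃p : ℝ → EuclideanSpace ℝ (Fin 3) → ℝ⦄,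
        ContDiffOn ℝ ∞ (uncurry u) (Ioo (-δ) T₀ ×ˢ ball 0 (4 * rc)) →
        ContDiffOn ℝ ∞ (uncurry p) (Ioo (-δ) T₀ ×ˢ ball 0 (4 * rc)) →
        (∀ t ∈ Ioo (-δ) T₀, ∀ x ∈ ball (0 : EuclideanSpace ℝ (Fin 3)) (4 * rc),
          deriv (fun s => u s x) t + convect (u t) (u t) x = Δ (u t) x - gradient (p t) x) →
        (∀ t ∈ Ioo (-δ) T₀, ∀ x ∈ ball (0 : EuclideanSpace ℝ (Fin 3)) (4 * rc),
          VectorCalculus.divergence (u t) x = 0) →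
        ∀ ⦃A B D : ℝ⦄, 0 ≤ A → 0 ≤ B → 0 ≤ D →
        (∀ t ∈ Ioo (-δ) T₀, eLpNorm (u t) (ENNReal.ofReal q)
            (volume.restrict (ball 0 (4 * rc))) ≤ ENNReal.ofReal A) →
        (∀ t ∈ Ioo (-δ) T₀, eLpNorm (p t) (ENNReal.ofReal (q / 2))
            (volume.restrict (ball 0 (4 * rc))) ≤ ENNReal.ofReal (B ^ 2)) →
        (∫⁻ t in Ioo (-δ) T₀, eLpNorm (fun x => Real.sqrt (frobeniusNormSq (fderiv ℝ (u t) x)))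
            (ENNReal.ofReal q) (volume.restrict (ball 0 (4 * rc))) ^ r ≤
          ENNReal.ofReal (D ^ r)) →
        1 < C⁻¹ * min (min T₀ (rc ^ 2))
            (q ^ 2 * (C * (A + B + T₀ ^ ((r - 2) / (2 * r)) * D)) ^ (2 * q / (q - 3)))⁻¹ →
        ∃ U : EuclideanSpace ℂ (Fin 3) → EuclideanSpace ℂ (Fin 3),
          DifferentiableOn ℂ U (localComplexTube 0 rc (1 / (4 * C₀))) ∧
          ∀ x ∈ ball (0 : EuclideanSpace ℝ (Fin 3)) rc, U (complexify x) = complexify (u 1 x)) :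
    bradshawGrujicKukavica2015_local_analyticity_radius :=
  bradshawGrujicKukavica2015_local_analyticity_radius_of_core hC₀ hC
    fun xc _ _ _ _ _ hrc hT₀ hq hr hδ _ _ hu hp hns hdiv _ _ _ hA hB hD huA hpB hgrad _ ht =>
      bgk_core_of_core_unit (one_pos.trans_le hC) hunit xc hrc hT₀ hq hr hδ hu hp hns hdiv
        hA hB hD huA hpB hgrad ht

end Literature.Analysis.FluidPDE

end
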